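import Summits.CriticalPhenomena.PercolationContinuityZ3.Theorems.FK.VolumeExponentialDecayConsequences
import Summits.CriticalPhenomena.PercolationContinuityZ3.Theorems.FK.UniquenessOfNonPercolationTheta
import Summits.CriticalPhenomena.PercolationContinuityZ3.Theorems.FK.FreeWiredCriticalPoint
import HarnessLib

/-!
# Below the finite-volume threshold `p̃_c^a(q)`: `θ⁰ = θ¹ = 0`, `p ≤ p_c(q)` (Grimmett 2006 (5.84)
# `p̃_c^a(q) ≤ p̃_c(q) ≤ p_c(q)`), and the infinite-volume random-cluster measure is UNIQUE (Thm. (5.33)(a))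

Claimed R42 (8)(c) in the cell INBOX at 2026-08-27T17:08:47Z by fkp-10a gen 350 under provision (ι) (coordinator fk-4 g257 closed 16:26Z 2026-08-27; the lane lead absorbs the registry word; silence = consent), addressed to the lane lead and the next seated coordinator fk-4 (ruling R137); lineage row FO-10a-g350 (self-suggested), package g350-volexp, label VX-F.
Support file of the `fk-continuity` cell (lineage fkp-10a, `--supports stmt-CriticalPhenomena-4575`); builds on
p205010 (kernel theorem, internal audit signed; external expert review pending).  No definitions, no named facts,
no sorries; standard axioms.  `d ≥ 1`, `0 ≤ p ≤ 1`, `q ≥ 1`.  UNCONDITIONAL structure in hypothesis form (the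
hypothesis is Grimmett's `L^a(p,q) = 0`, i.e. `p < p̃_c^a(q)`); nothing is decided about Conj. (5.85)/(5.54), FH /
TP_FK, or the value of `p_c(q)`.

Grimmett 2006, §5.6 (5.84): "Clearly `p̃_c^a(q)` is non-decreasing in `a`, and furthermore `p̃_c^a(q) ≤ p̃_c(q)` for all
`a ≥ 1`", with (5.67) `p̃_c(q) ≤ p_c(q)`; §5.3 p. 107 (after Thm. (5.33)): "there exists a unique random-cluster
measure whenever `θ¹(p,q) = 0`".  From `VolumeExponentialDecayConsequences.lean` (no percolation for ANY measure of
the sandwich class under `L^a(p,q) = 0`) and the tree's uniqueness-of-non-percolation files: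

* **`thetaWired_eq_zero_of_tendsto`**, `thetaFree_eq_zero_of_tendsto` — `θ¹(p,q) = θ⁰(p,q) = 0`;
* **`le_rcCriticalProb_of_tendsto`** — `p ≤ p_c(q)` (i.e. `p̃_c^a(q) ≤ p_c(q)`);
* **`rcLimit_false_eq_rcLimit_true_of_tendsto`** — `φ⁰_{p,q} = φ¹_{p,q}`;
  **`FKGibbs.eq_rcLimit_false_of_tendsto`**, `fkGibbs_iff_eq_rcLimit_false_of_tendsto` — the sandwich class is the
  singleton `{φ⁰_{p,q}}` (every DLR / limit random-cluster measure at `(p,q)` is `φ⁰_{p,q}`);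
* `freeEdgeDensity_eq_wiredEdgeDensity_of_tendsto` — `h⁰(p,q) = h¹(p,q)` (no latent heat below `p̃_c^a(q)`).

## References

* G. Grimmett, *The Random-Cluster Model*, Springer 2006: §5.6 (5.83)–(5.86); §5.5 (5.67); Thm. (5.33)(a) and the
  remark after it (p. 107); Thm. (4.63). [Grimmett2006]
-/

noncomputable section

open scoped Classical Topology
open MeasureTheory Finset Filter

namespace Summit.CriticalPhenomena.PercolationContinuityZ3.Theorems

namespace FK

open Literature.Probability.LatticeModels Literature.Probability.Percolation
  Literature.Probability.Percolation.DCT16 Literature.Barriers.CriticalPhenomena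

variable {d : ℕ} {p q : ℝ} {P : Measure (BondConfig (Site d))}

/-- **`θ¹(p,q) = 0` below `p̃_c^a(q)`**: if `n^{d-1} φ¹_{Λ_{an},p,q}(0 ↔ ∂Λ_n) → 0` for some integer `a ≥ 1`
(`d ≥ 1`, `0 ≤ p ≤ 1`, `q ≥ 1`), then the wired percolation probability vanishes (the wired limit `φ¹_{p,q}` is a
member of the sandwich class, which does not percolate: `FKGibbs.real_percolatesAt_eq_zero_of_tendsto`).
[cite: Grimmett2006, §5.6 (5.84) with (5.67): p̃_c^a(q) ≤ p_c(q)] -/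
theorem thetaWired_eq_zero_of_tendsto (hd : 0 < d) (hp : p ∈ Set.Icc (0 : ℝ) 1) (hq : 1 ≤ q) {a : ℕ} (ha : 1 ≤ a)
    (hL : Tendsto (fun n : ℕ => (n : ℝ) ^ (d - 1) * regionWiredReal d p q (box d (a * n)) (siteToBoundary d n))
      atTop (𝓝 0)) :
    thetaWired d p q = 0 := by
  rw [← rcLimit_true_real_percolatesAt hp hq]
  exact ((isBoxLimit_rcLimit true hp hq).fkGibbs hp hq).real_percolatesAt_eq_zero_of_tendsto hd hp hq ha hL

/-- **`θ⁰(p,q) = 0` below `p̃_c^a(q)`** (same hypotheses). [cite: Grimmett2006, §5.6 (5.84) with (5.67)] -/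
theorem thetaFree_eq_zero_of_tendsto (hd : 0 < d) (hp : p ∈ Set.Icc (0 : ℝ) 1) (hq : 1 ≤ q) {a : ℕ} (ha : 1 ≤ a)
    (hL : Tendsto (fun n : ℕ => (n : ℝ) ^ (d - 1) * regionWiredReal d p q (box d (a * n)) (siteToBoundary d n))
      atTop (𝓝 0)) :
    thetaFree d p q = 0 := by
  rw [← rcLimit_false_real_percolatesAt hp hq]
  exact ((isBoxLimit_rcLimit false hp hq).fkGibbs hp hq).real_percolatesAt_eq_zero_of_tendsto hd hp hq ha hL

/-- **`p̃_c^a(q) ≤ p_c(q)`** (Grimmett 2006 (5.84) with (5.67)): under the hypothesis `L^a(p,q) = 0`, `p ≤ p_c(q)`.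
[cite: Grimmett2006, §5.6 (5.84), §5.5 (5.67)] -/
theorem le_rcCriticalProb_of_tendsto (hd : 0 < d) (hp : p ∈ Set.Icc (0 : ℝ) 1) (hq : 1 ≤ q) {a : ℕ} (ha : 1 ≤ a)
    (hL : Tendsto (fun n : ℕ => (n : ℝ) ^ (d - 1) * regionWiredReal d p q (box d (a * n)) (siteToBoundary d n))
      atTop (𝓝 0)) :
    p ≤ rcCriticalProb d q :=
  le_rcCriticalProb_of_thetaFree_eq_zero hq hp (thetaFree_eq_zero_of_tendsto hd hp hq ha hL)

/-- **Uniqueness below `p̃_c^a(q)`: `φ⁰_{p,q} = φ¹_{p,q}`** (Thm. (5.33)(a): `θ¹(p,q) = 0` forces uniqueness).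
[cite: Grimmett2006, Thm. (5.33)(a) and the remark after it, p. 107; §5.6 (5.84)] -/
theorem rcLimit_false_eq_rcLimit_true_of_tendsto (hd : 0 < d) (hp : p ∈ Set.Icc (0 : ℝ) 1) (hq : 1 ≤ q) {a : ℕ}
    (ha : 1 ≤ a)
    (hL : Tendsto (fun n : ℕ => (n : ℝ) ^ (d - 1) * regionWiredReal d p q (box d (a * n)) (siteToBoundary d n))
      atTop (𝓝 0)) :
    rcLimit d false p q = rcLimit d true p q :=
  rcLimit_false_eq_rcLimit_true_of_thetaWired_eq_zero hp hq (thetaWired_eq_zero_of_tendsto hd hp hq ha hL)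

/-- **Every measure of the sandwich class below `p̃_c^a(q)` is `φ⁰_{p,q}`** (DLR measures, limits with arbitrary
boundary conditions, …). [cite: Grimmett2006, Thm. (5.33)(a) and the remark after it, p. 107] -/
theorem FKGibbs.eq_rcLimit_false_of_tendsto (hP : FKGibbs d p q P) (hd : 0 < d) (hp : p ∈ Set.Icc (0 : ℝ) 1)
    (hq : 1 ≤ q) {a : ℕ} (ha : 1 ≤ a)
    (hL : Tendsto (fun n : ℕ => (n : ℝ) ^ (d - 1) * regionWiredReal d p q (box d (a * n)) (siteToBoundary d n))
      atTop (𝓝 0)) :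
    P = rcLimit d false p q :=
  hP.eq_rcLimit_false_of_thetaWired_eq_zero hp hq (thetaWired_eq_zero_of_tendsto hd hp hq ha hL)

/-- The sandwich class below `p̃_c^a(q)` is the singleton `{φ⁰_{p,q}}`: `FKGibbs d p q P ↔ P = φ⁰_{p,q}`.
[cite: Grimmett2006, Thm. (5.33)(a) and the remark after it, p. 107] -/
theorem fkGibbs_iff_eq_rcLimit_false_of_tendsto (hd : 0 < d) (hp : p ∈ Set.Icc (0 : ℝ) 1) (hq : 1 ≤ q) {a : ℕ}
    (ha : 1 ≤ a)
    (hL : Tendsto (fun n : ℕ => (n : ℝ) ^ (d - 1) * regionWiredReal d p q (box d (a * n)) (siteToBoundary d n))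
      atTop (𝓝 0)) :
    FKGibbs d p q P ↔ P = rcLimit d false p q :=
  fkGibbs_iff_eq_rcLimit_false_of_thetaWired_eq_zero hp hq (thetaWired_eq_zero_of_tendsto hd hp hq ha hL)

/-- **No latent heat below `p̃_c^a(q)`**: the free and wired edge densities agree, `h⁰(p,q) = h¹(p,q)`
(Thm. (4.63) `(a) ⇒ (c)`). [cite: Grimmett2006, Thm. (4.63) with Thm. (5.33)(a)] -/
theorem freeEdgeDensity_eq_wiredEdgeDensity_of_tendsto (hd : 0 < d) (hp : p ∈ Set.Icc (0 : ℝ) 1) (hq : 1 ≤ q)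
    {a : ℕ} (ha : 1 ≤ a)
    (hL : Tendsto (fun n : ℕ => (n : ℝ) ^ (d - 1) * regionWiredReal d p q (box d (a * n)) (siteToBoundary d n))
      atTop (𝓝 0)) {e : Sym2 (Site d)} (he : e ∈ (zdGraph d).edgeSet) :
    freeEdgeDensity d p q e = wiredEdgeDensity d p q e :=
  freeEdgeDensity_eq_wiredEdgeDensity_of_thetaWired_eq_zero hp hq (thetaWired_eq_zero_of_tendsto hd hp hq ha hL) he

end FK

end Summit.CriticalPhenomena.PercolationContinuityZ3.Theorems

end
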